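import Mathlib
import Summits.Ventures.HodgeRepro.Tier4.Target
import Summits.Ventures.HodgeRepro.Tier4.Line3.Defs
import Summits.Ventures.HodgeRepro.Tier4.Line3.DefsLemmas
import Summits.Ventures.HodgeRepro.Tier4.Line3.GaussRatioFormula
import Summits.Ventures.HodgeRepro.Tier4.Line3.CopyWeightGaussian
import Summits.Ventures.HodgeRepro.Tier4.Line3.ShrinkMajGauss

/-!
# Tier4/Line3/RatioWindow — any positive ratio can be moved into the closed window `[1/η₀, η₀]` by an even power of `η₀`

Blind re-derivation cell `pub-hodge-repro`, Tier 4 «PROVE THE STEP», LINE L3, seat t4-x2 (g3, reserve wall-breaker); the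
arithmetic remark of proofs/t4/L3/ARCH-COPY-PROFILE-x2.md §8: scaling a centre by a unit `u` with `τ₀(c(u) u) = η₀`
multiplies the slot ratio `r = 2q/h` by `η₀^{−2}`, a step of exactly the multiplicative width of the window
`(1/η₀, η₀)` of QuarticProfile, so some unit multiple of any centre lands in the CLOSED window
(`exists_zpow_mem_window`), and in the open window unless the ratio is an odd power of `η₀` (`exists_zpow_mem_open_window`).
Pure real analysis (Mathlib only).

Nothing here says anything about the status of the Hodge conjecture for CM abelian varieties, which is NOT proved
(HC_CM is NOT proved by anyone in this repository).
-/

set_option autoImplicit false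

noncomputable section

namespace Summit.Ventures.HodgeRepro.Tier4.Line3

/-- **THE CLOSED WINDOW**: for `η₀ > 1` and `r > 0` there is `k : ℤ` with `1/η₀ ≤ r · η₀^(2k) ≤ η₀`. -/
theorem exists_zpow_mem_window {η₀ r : ℝ} (hη : 1 < η₀) (hr : 0 < r) :
    ∃ k : ℤ, 1 / η₀ ≤ r * η₀ ^ (2 * k) ∧ r * η₀ ^ (2 * k) ≤ η₀ := by
  have hη0 : 0 < η₀ := by linarith
  have hlog : 0 < Real.log η₀ := Real.log_pos hη
  set L : ℝ := Real.log r / Real.log η₀ with hL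
  have hLmul : L * Real.log η₀ = Real.log r := div_mul_cancel₀ _ hlog.ne'
  have key : ∀ k : ℤ, Real.log (r * η₀ ^ (2 * k)) = Real.log r + (2 * (k : ℝ)) * Real.log η₀ := by
    intro k
    rw [Real.log_mul hr.ne' (zpow_ne_zero _ hη0.ne'), Real.log_zpow]
    push_cast
    ring
  set k : ℤ := ⌈(-1 - L) / 2⌉ with hk
  have hk1 : -1 - L ≤ 2 * (k : ℝ) := by
    have := Int.le_ceil ((-1 - L) / 2)
    rw [← hk] at this
    linarith
  have hk2 : 2 * (k : ℝ) ≤ 1 - L := by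
    have := Int.ceil_lt_add_one ((-1 - L) / 2)
    rw [← hk] at this
    linarith
  have hpos : 0 < r * η₀ ^ (2 * k) := mul_pos hr (zpow_pos hη0 _)
  refine ⟨k, ?_, ?_⟩
  · rw [one_div, ← Real.log_le_log_iff (inv_pos.2 hη0) hpos, Real.log_inv, key]
    have h2 := mul_le_mul_of_nonneg_right hk1 hlog.le
    have h3 : (-1 - L) * Real.log η₀ = -Real.log η₀ - Real.log r := by
      rw [sub_mul, ← hLmul]
      ring
    linarith
  · rw [← Real.log_le_log_iff hpos hη0, key]
    have h2 := mul_le_mul_of_nonneg_right hk2 hlog.le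
    have h3 : (1 - L) * Real.log η₀ = Real.log η₀ - Real.log r := by
      rw [sub_mul, ← hLmul]
      ring
    linarith

namespace T4Data

variable (X : T4Data)

open NumberField

/-- The `τ₀`-size scales by `‖τ₀ λ‖²` under a scalar `λ`. -/
theorem tauSize_smul (lam : X.E) (x : Fin 3 → X.E) : X.tauSize (lam • x) = ‖X.τ₀ lam‖ ^ 2 * X.tauSize x := by
  unfold tauSize
  rw [X.hform_smul, map_mul, map_mul, norm_mul, norm_mul, ← X.conj_tau, Complex.norm_conj]
  ring

/-- The slot ratio `2 q / h` scales by `‖σ λ‖² / ‖τ₀ λ‖²` under a scalar `λ ≠ 0`. -/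
theorem ratio_smul (σ : X.E →+* ℂ) {lam : X.E} (hlam : lam ≠ 0) (x : Fin 3 → X.E) (hx : x ≠ 0) :
    2 * X.defQuad σ (lam • x) / X.tauSize (lam • x) =
      (‖σ lam‖ ^ 2 / ‖X.τ₀ lam‖ ^ 2) * (2 * X.defQuad σ x / X.tauSize x) := by
  rw [X.defQuad_smul, X.tauSize_smul]
  have h1 : X.tauSize x ≠ 0 := (X.tauSize_pos hx).ne'
  have h2 : ‖X.τ₀ lam‖ ≠ 0 := norm_ne_zero_iff.2 ((map_ne_zero _).2 hlam)
  field_simp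

/-- **A UNIT POWER PUTS THE SLOT RATIO IN THE CLOSED WINDOW**: for a unit `u` with `‖τ₀ u‖² = η₀` and `‖σ u‖² = 1/η₀` at the
definite embedding `σ` (the sizes of a unit with `τ₀(c(u) u) = η₀` on a quartic field — displayed), every slot `x ≠ 0` has an
integer `k` with `1/η₀ ≤ 2 q/h ≤ η₀` for the scaled slot `u^k • x`. -/
theorem exists_zpow_smul_ratio_mem_window (σ : X.E →+* ℂ) {u : X.E} (hu : u ≠ 0) {η₀ : ℝ} (hη : 1 < η₀)
    (hu1 : ‖X.τ₀ u‖ ^ 2 = η₀) (hu2 : ‖σ u‖ ^ 2 = 1 / η₀) {x : Fin 3 → X.E} (hx : x ≠ 0) (hq : 0 < X.defQuad σ x) :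
    ∃ k : ℤ, 1 / η₀ ≤ 2 * X.defQuad σ (u ^ k • x) / X.tauSize (u ^ k • x) ∧
      2 * X.defQuad σ (u ^ k • x) / X.tauSize (u ^ k • x) ≤ η₀ := by
  have hη0 : 0 < η₀ := by linarith
  have hr : 0 < 2 * X.defQuad σ x / X.tauSize x := by
    have := X.tauSize_pos hx
    positivity
  obtain ⟨k, hk1, hk2⟩ := exists_zpow_mem_window hη hr
  have e1 : ‖σ (u ^ (-k))‖ ^ (2 : ℕ) = (‖σ u‖ ^ (2 : ℕ)) ^ (-k) := by
    rw [map_zpow₀, norm_zpow, ← zpow_natCast, ← zpow_natCast, ← zpow_mul, ← zpow_mul, mul_comm]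
  have e2 : ‖X.τ₀ (u ^ (-k))‖ ^ (2 : ℕ) = (‖X.τ₀ u‖ ^ (2 : ℕ)) ^ (-k) := by
    rw [map_zpow₀, norm_zpow, ← zpow_natCast, ← zpow_natCast, ← zpow_mul, ← zpow_mul, mul_comm]
  have hs : ‖σ (u ^ (-k))‖ ^ 2 / ‖X.τ₀ (u ^ (-k))‖ ^ 2 = η₀ ^ (2 * k) := by
    rw [e1, e2, hu1, hu2, one_div, inv_zpow, zpow_neg, inv_inv, div_inv_eq_mul, ← zpow_add₀ hη0.ne',
      two_mul]
  refine ⟨-k, ?_, ?_⟩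
  · rw [X.ratio_smul σ (zpow_ne_zero _ hu) x hx, hs]
    linarith [hk1]
  · rw [X.ratio_smul σ (zpow_ne_zero _ hu) x hx, hs]
    linarith [hk2]

end T4Data

end Summit.Ventures.HodgeRepro.Tier4.Line3

end
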